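import Summits.BirchSwinnertonDyer.Rank1Residual.F1Sign2.LocalTowerSignLawAtTwo
import Literature.NumberTheory.EllipticCurves.LangHeightNonarchEstimate
import HarnessLib

/-!
# Cell `bsd-f1-sign2`, DESC-§23: THE DEEP TWIST, TYPED — the deep-twist Néron laws at `2` (-desc g15, MEMO-desc §23; CANDIDATES-delta DESC v23.0)

TYPER FILING (cell `bsd-f1-sign2`, seat `-ty` g10; CANDIDATES.md rows DESC-§23-F/TS/T/TY + carriers; -desc g15 filing ask D-desc-37
«file `F1Sign2/DeepTwistLawsAtTwo.lean` = body of `MEMO-desc-data/g15/lean/SketchG15DeepTwist.lean` acc170c3bcf09fa5 after REF1; rows T/TY/TS/F + carriers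
`IsTowerStepGenerator/deepTwist/discHilbertSymbolTwo/twoAdicTwoTorsionRootCount/indicatorInt`; farm rc 0 · 0/0/0; BC7 4/4 CLEAN `ProbeG15DeepTwist.out`
9473e4650707b64b»): the sketch body VERBATIM — same namespace `…Rank1Residual.F1Sign2` (flat, next to `LocalTowerSignLawAtTwo`), same imports
(`F1Sign2.LocalTowerSignLawAtTwo`, `Literature.…LangHeightNonarchEstimate` for `kodairaSymbolAt`/`tamagawaNumberAt`/`conductorExponent` over
number fields).  Decls: carriers `IsTowerStepGenerator`, `deepTwist`, `discHilbertSymbolTwo`, `twoAdicTwoTorsionRootCount`, `indicatorInt`;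
rows `DeepTwistConductorLawAtTwo` (F, support, KNOWN-type), `DeepTwistTamagawaParityLawAtTwo` (TS), `DeepTwistEulerParityLawAtTwo` (T = (T_n) of
REF2 v28, model-free; the route-free local target of IMC-LTS `LocalTowerSignLawAtTwo`), `DeepTwistNeronTypeLawAtTwo` (TY, potentially good
`f₂ ≥ 3`; -desc D-desc-36: the TYPED local form of -imc's D-imc-34 target).  Typer edits = this header and the REF1/REF2 sentences.  Nothing is
asserted: `def … : Prop` only.
Census = BC5 WITNESS (two engines for the twist data): REF2 v28 table `HOME/REF2-data/v28-ktd/ktd_rows.jsonl` (tate.py 38f95975a27fdb4b, 17 968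
(curve, step) cells, n ≤ 4) × -desc kit j309612 (tag `bsd-frontier-data`, PARI `elllocalred` over `nfinit(p_k)`, `δ = Mod(2+x, p_k)`): 17 968/17 968
cells agree on (Kod′, c′, f′, v(u′), v(Δ′_min)), INV 4 492/4 492; (F) 13 382/13 382 in-range cells + 4 492/4 492 at n = 5; (TS) 12 430/12 430 deep
cells (fails on 75 of the 952 edge cells, all `I*_m`); (T) 13 382/13 382 + 4 492/4 492; (TY) 7 211/7 211 deep cells at n = 2, 3, 4 + 2 719/2 719 curves
at n = 5 (PARI, kit j309696), 0 exceptions; files `HOME/MEMO-desc-data/g15/` (`README-23.md`, `SHA16SUMS`; `kit/tw2-all-j309612.out` 362ca878eb169ccf,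
`kit/tw2-n5-j309696.out` 3db82e18980775f1, `an23/a8.out` census of record).
REF1-AUDIT §113 (refuter-bsd-f1-sign2-ref1 g10, 2026-08-28T14:14:28Z; evidence `HOME/REF1-data/b113/`; gate D-ty-ref1-29 CLEARED: -ty draft 0edecd1372d4d783 = sketch acc170c3bcf09fa5, cmpdecls 9/9 SAME): «DESC-§23 rows of SketchG15DeepTwist acc170c3bcf09fa5 — `DeepTwistConductorLawAtTwo` SURVIVES (theorem-grade in substance, KNOWN conductor identity), `DeepTwistTamagawaParityLawAtTwo` SURVIVES (conjecture-grade), `DeepTwistEulerParityLawAtTwo` SURVIVES (⟺ LocalTowerSignLawAtTwo cell by cell), `DeepTwistNeronTypeLawAtTwo` SURVIVES (conjecture-grade; hypotheses 0 ≤ v₂ j and 3 ≤ f₂ possibly unnecessary); carriers `IsTowerStepGenerator`/`deepTwist`/`discHilbertSymbolTwo` (= (Δ,2)₂ exactly)/`twoAdicTwoTorsionRootCount`/`indicatorInt` correct; KILLED none; rc 0; Probe113 e1 ((T)∧(TS) ⟹ (SU) kernel glue), e2 ((TY) ⟹ (TS) pointwise; (a¬□) forces (Δ,2)₂ = −1 —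 true by the tame-cubic lemma), e3 χ₈ convention, e4 junk guard, e6 model-invariance needs k ≥ 1; literal replay on three engines (X5 n ≤ 5, j309833, j309889): F 76 386 · T 76 386 · TS 63 698 · TY 44 939 cells, 0 failures; riders r1–r5 text-only.» Typer uptake: r4 (h21 classes) — `@[conjecture]` ADDED on (TS) `DeepTwistTamagawaParityLawAtTwo`, (T) `DeepTwistEulerParityLawAtTwo` (⟺ `LocalTowerSignLawAtTwo` cell by cell, REF2 v28 (KTD_n)) and (TY) `DeepTwistNeronTypeLawAtTwo` (attribute only, statements verbatim); (F) stays a plain support `def` (KNOWN-type: Katz GKM L.1.3, REF2 v30 §4.1); r3 docstring sentences folded on `discHilbertSymbolTwo` and (TY); r1 (drop `0 ≤ v₂ j`, `3 ≤ f₂`: the optional STRONGER row TY♯ on all additive `W`, 18 877 extra cells) and r2 (TY♭) are -desc's calls — TY as filed is the weaker row (-desc v23.3 has meanwhile typed intrinsic F♯/TY♯/TR♯ over any `K ∋ v ∣ 2`, `SketchG15Intrinsic.lean`, a separate filing); r5 (-imc successor / prover): the kernel glue worth filing next to the rows is e1's shape ((T) ∧ (TS) ⟹ (SU)) and e2's pointwise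 (TY) ⟹ (TS).
REF2-PLACEMENT v30 §4 (refuter-bsd-f1-sign2-ref2 g30, 2026-08-28T13:53:46Z; `HOME/REF2-PLACEMENT-v30.md`): «(F) f(W ⊗ η_n / ℚ_{n−1}) = 2^{n+1} + 2 = 2·f(η_n): KNOWN — Katz, Gauss Sums, Kloosterman Sums and Monodromy Groups (1988) Ch. 1 Lemma 1.3 + Def. 1.6 [corpus p0016 L42–44, p0018] «a(σ⊗χ) = dim σ·a(χ) beyond the breaks» (-imc §10.76 (b3): + Serre LF IV §4 Herbrand; priority -desc §23-add1 (F♯)); (TY)/(TS) (Néron type / Tamagawa parity of W ⊗ η_n over the totally real layer ℚ₂(ζ_{2^{n+1}})⁺ in the potentially-good range; closed forms m = 2^{n−1}(8 − v₂ j)⁺, c′ = 3 + (Δ,2)₂): NOT FOUND IN PRINT as displayed; COMPUTABLE FROM PRINT (Tate's algorithm over the layer; Kraus 1990 manuscripta 69; Papadopoulos 1993 JNT 44; Comalada 1994 acq-13993; Dokchitser–Dokchitser 2011 Crelle §§3–4; Coppola 2020; Dembélé–Freitas–Voight 2024; Barrios et al. 2025 arXiv:2501.03209 K = ℚ₂ only;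 REF2 v32 r-32a: Comalada 1994's residue-characteristic-2 twist rows are flagged erroneous there (p. 4); Wang 2024 Cor. 2.12, Lorenzini 2010 Thm 2.8 (quadratic-semistable twist types) do not apply at e(W) = 24 — REF2 v31 §2.2, v32 §1.2) → grade VARIANT (known algorithm, new closed form on this tower; the census is the evidence); beyond-print theorem: no (a correct closed form here is a computation); (T) = (F) + (TY)/(TS) assembled ⟹ grade follows the parts (KNOWN ⊕ VARIANT); its equivalence with `LocalTowerSignLawAtTwo` ⟺ (T_n) placed in v28 §1 (Česnavičius–Imai / DD 2011 / Rohrlich) — unchanged.» [cite: KramerTunnell1982, Thm. 7.6] [cite: DokchitserDokchitser2011, Thm. 5, §3–§4]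
PARTITION: none moved (frontier tier; (T) ⟺ IMC-LTS cell by cell via KT82 Thm 7.6 + DD11 Thm 5, REF2 v28 (KTD_n) 17 968/17 968); beyond-print
theorem: no (conjecture + census; REF2 to grade, -desc expects NEW-COMBINATION).  BSD is not proved by any of this.
bears_on: F1Sign2 leaf (IMC-LTS `LocalTowerSignLawAtTwo`, p636363; D-imc-34 first target (T_2)^{f₂=3}); asks D-desc-36 (-imc), D-desc-38 (REF2),
D-desc-39 (REF1), D-desc-40 (-data).

## The sketch's own summary (verbatim)

# Cell `bsd-f1-sign2`, lens `-desc` g15 (MEMO-desc §23): the DEEP-TWIST Néron laws at `2`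

The in-tree conjecture `LocalTowerSignLawAtTwo` (IMC-LTS, p636363) is, cell by cell, EQUIVALENT (Kramer–Tunnell 1982
Thm 7.6 at residue characteristic 2 + Dokchitser–Dokchitser 2011 Thm 5; REF2 v28 §1) to the parity statement (T_n) about
Tate's algorithm for ONE quadratic twist: the twist `W ⊗ η_n` of `W` over the layer `ℚ_{n−1}` by any `δ` with
`ℚ_n = ℚ_{n−1}(√δ)` (for the cyclotomic tower `δ ≡ 2 + ζ_{2^{n+1}} + ζ_{2^{n+1}}⁻¹` modulo squares).  This sketch TYPES that
twist over tree declarations (`ZpExtension.layer`, `WeierstrassCurve.quadraticTwist`, `kodairaSymbolAt`, `tamagawaNumberAt`,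
`ordMinimalDiscriminant`, `conductorExponent`) and states the -desc g15 DECOMPOSITION of (T_n) found in the REF2 v28 table
(`REF2-data/v28-ktd/ktd_rows.jsonl`, 17 968 (curve, step) cells, n ≤ 4; second engine PARI `elllocalred` over the layer field,
kit j309612: 17 968/17 968 cells agree on all five twist data) into separately holding laws:

* `DeepTwistConductorLawAtTwo` (F): `f(W ⊗ η_n / ℚ_{n−1}) = 2^{n+1} + 2 = 2·f(η_n)` for `n ≥ 2`, `f₂ ≤ 2n + 2` (13 382/13 382 at `n ≤ 4`, 4 492/4 492 at `n = 5`;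
  in substance KNOWN: `a(σ ⊗ η) = dim σ · a(η)` when the break of `η` exceeds those of `σ_W`);
* `DeepTwistNeronTypeLawAtTwo` (TY): for potentially good `W` with `f₂ ≥ 3`, `n ≥ 2`, `f₂ ≤ 2n`, the Kodaira symbol and the
  Tamagawa number of the deep twist are READ OFF `W/ℚ₂`: `W(ℚ₂)[2] = 0` ⇒ `c′ = 1` and type `I₀*` / `II` / `II*` according as
  `Δ_W ∈ ℚ₂^{×2}` / `2^{n−1}(8+v₂Δ_W) ≡ 8` / `≡ 4 (mod 12)`; `W(ℚ₂)[2] ≠ 0` ⇒ `c′ = 3 + (Δ_W,2)₂ ∈ {2,4}` and type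
  `I*_m`, `m = 2^{n−1}·max(0, 8 − v₂(j_W))` (2 719 curves: 7 211/7 211 deep cells at `n = 2, 3, 4`, two engines; 2 719/2 719 at
  `n = 5`, PARI engine, kit j309696; 0 exceptions);
* `DeepTwistTamagawaParityLawAtTwo` (TS): `v₂(c′_n) ≡ [(Δ_W,2)₂ = −1] + [type ∈ {II, II*}] (mod 2)` on ALL additive `W`
  (`4 ∣ N`), `n ≥ 2`, `f₂ ≤ 2n` (12 430/12 430 at `n ≤ 4`, all strata incl. `f₂ = 2` and potentially multiplicative; 4 492/4 492 at `n = 5`);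
* `DeepTwistEulerParityLawAtTwo` (T): the parity law (T_n) itself in model-free form, `n ≥ 2`, `f₂ ≤ 2n + 2`
  (13 382/13 382 at `n ≤ 4`; 4 492/4 492 at `n = 5`) — the statement REF2 v28 r1 records as the prover's target for IMC-LTS and could not yet be typed
  («the layer functions take curves over ℚ»): here the twist is a `WeierstrassCurve` over `↥(κ.layer (n−1))`.

Nothing is asserted: `def … : Prop` only.  All quantities are `ℚ_{n−1}`-isomorphism invariants of the twist (its class depends
on `δ` modulo squares only, `exists_variableChange_quadraticTwist_mul_sq`), and the `W`-side quantities are used only through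
model-invariant combinations (`2^{n−1}·v₂(Δ_W) mod 24` for `n ≥ 2`, `v₂(j_W)`, the square class of `Δ_W` in `ℚ₂^×`, the number of
`ℚ₂`-rational `2`-torsion abscissae).  Indexing: `k = n − 1 ≥ 1` is the base layer, the twist lives over `ℚ_k`, `n = k + 1`.
-/

noncomputable section

open scoped Classical NumberField

open WeierstrassCurve Literature.NumberTheory.EllipticCurves Literature.NumberTheory.DiophantineGeometry
  Literature.NumberTheory.EllipticCurves.Rank1Residual ZpExtension IsDedekindDomain

namespace Summit.BirchSwinnertonDyer.Rank1Residual.F1Sign2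

/-- `δ ∈ ℚ_k` generates the next layer of `κ`: `δ ∉ ℚ_k^{×2}` and `√δ ∈ ℚ_{k+1}`; since `[ℚ_{k+1} : ℚ_k] = 2` this says
`ℚ_{k+1} = ℚ_k(√δ)` and pins `δ` modulo squares (Kummer theory).  For the cyclotomic `κ`: `δ ≡ 2 + ζ_{2^{k+2}} + ζ_{2^{k+2}}⁻¹`. -/
def IsTowerStepGenerator (κ : ZpExtension ℚ 2) (k : ℕ) (δ : ↥(κ.layer k)) : Prop :=
  ¬ IsSquare δ ∧ ∃ y : ↥(κ.layer (k + 1)), (y : AlgebraicClosure ℚ) ^ 2 = (δ : AlgebraicClosure ℚ)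

/-- **The deep twist** `W ⊗ η_{k+1}` over the layer `ℚ_k`: the quadratic twist of `W/ℚ_k` by a step generator `δ`
(model `y² = x³ + δ(b₂/4)x² + δ²(b₄/2)x + δ³(b₆/4)`, `WeierstrassCurve.quadraticTwist`). -/
def deepTwist (W : WeierstrassCurve ℚ) (κ : ZpExtension ℚ 2) (k : ℕ) (δ : ↥(κ.layer k)) :
    WeierstrassCurve ↥(κ.layer k) :=
  (W.baseChange ↥(κ.layer k)).quadraticTwist δ

/-- The Hilbert symbol `(Δ_W, 2)₂ ∈ {±1}`: `= χ₈(u)` for `Δ_W = 2^a·u`, `u ∈ ℤ₂^×` (here `u ∈ ℚ` with odd numerator and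
denominator, `χ₈(u) = χ₈(num)·χ₈(den)`).  Junk `0·… = 0`-free: for `Δ_W = 0` the value is `χ₈(0)·χ₈(1) = 0`.
REF1 §113 r3: `(2,2)₂ = 1`, so no correction for odd `v₂Δ` (this IS `(Δ,2)₂` exactly, e3); in the rows over `ℚ_k` it stands for `(Δ_W, δ)_v` because
`N_{ℚ_{k,v}/ℚ₂}(δ) ∈ 2·ℚ₂^{×2}`. -/
def discHilbertSymbolTwo (W : WeierstrassCurve ℚ) : ℤ :=
  let u : ℚ := W.Δ / (2 : ℚ) ^ padicValRat 2 W.Δ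
  ZMod.χ₈ (u.num : ZMod 8) * ZMod.χ₈ (u.den : ZMod 8)

/-- The number of `ℚ₂`-rational `2`-torsion abscissae of `W`: roots in `ℚ₂` of the `2`-division polynomial
`4x³ + b₂x² + 2b₄x + b₆` (`∈ {0, 1, 3}` for elliptic `W`; `= #W(ℚ₂)[2] − 1`). -/
def twoAdicTwoTorsionRootCount (W : WeierstrassCurve ℚ) : ℕ :=
  Set.ncard {x : ℚ_[2] | (4 : ℚ_[2]) * x ^ 3 + (W.b₂ : ℚ_[2]) * x ^ 2 + 2 * (W.b₄ : ℚ_[2]) * x + (W.b₆ : ℚ_[2]) = 0}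

/-- `[P]` as an integer. -/
def indicatorInt (P : Prop) : ℤ := if P then 1 else 0

/-- **(F) Deep-twist conductor law.**  For `W/ℚ` elliptic and additive at `2` (`4 ∣ N_W`), the cyclotomic `ℤ₂`-extension `κ`,
`k ≥ 1` and `f₂(W) ≤ 2k + 4` (= `2n + 2`, `n = k + 1`): at every prime `v ∣ 2` of `ℚ_k` the conductor exponent of the deep twist
is `f_v(W ⊗ η_{k+1}) = 2^{k+2} + 2` (`= 2·f(η_{k+1})`, `f(η_{k+1}) = v(4δ) = 2^{k+1} + 1`).  Census (REF2 v28 table, Ogg-consistent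
0 violations): 13 382/13 382 cells `n = 2, 3, 4`; at `n = 1` it reads `f = 6` for `f₂ ≤ 5` and FAILS for `f₂ ≥ 6` (cancellation),
which is why `k ≥ 1`.  In substance the Artin-conductor identity `a(σ_W ⊗ η) = 2·a(η)` for a character whose break exceeds the
breaks of `σ_W`; filed as support (KNOWN-type). -/
def DeepTwistConductorLawAtTwo : Prop :=
  ∀ (W : WeierstrassCurve ℚ) [W.IsElliptic], 4 ∣ W.conductorNorm ℤ →
    ∀ (κ : ZpExtension ℚ 2), κ.IsCyclotomic → ∀ k : ℕ, 1 ≤ k → conductorExponentAtTwo W ≤ 2 * k + 4 →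
      ∀ δ : ↥(κ.layer k), IsTowerStepGenerator κ k δ →
        haveI : FiniteDimensional ℚ ↥(κ.layer k) := κ.finiteDimensional_layer_holds k
        haveI : NumberField ↥(κ.layer k) := NumberField.of_module_finite ℚ ↥(κ.layer k)
        ∀ v : HeightOneSpectrum (𝓞 ↥(κ.layer k)), (2 : 𝓞 ↥(κ.layer k)) ∈ v.asIdeal →
          (deepTwist W κ k δ).conductorExponent v = 2 ^ (k + 2) + 2

/-- **(TS) Deep-twist Tamagawa parity law** (the -desc reading: «the component group of the deep twist has EVEN `2`-valuation
iff the twisting uniformiser is a norm from the `2`-division field, up to the `II/II*` exception»; `(Δ_W, δ)_{ℚ_k,v} = (Δ_W, 2)₂`).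
Scope: `W` additive at `2`, `k ≥ 1`, `f₂ ≤ 2k + 2` (the DEEP range `f₂ ≤ 2n`); all strata (potentially multiplicative, `f₂ = 2`,
potentially good `f₂ ≥ 3`).  Census 12 430/12 430 cells (`n = 2, 3, 4`); it FAILS at 75 of the 952 edge cells `f₂ ∈ {2n+1, 2n+2}`
(all of type `I*_m`: 41 at `(n, f₂) = (2, 5)`, 22 at `(2, 6)`, 12 at `(3, 7)`), where only the sum (T) survives.
REF1 §113: SURVIVES conjecture-grade, tagged `@[conjecture]` (r4, typer edit). -/
@[conjecture] def DeepTwistTamagawaParityLawAtTwo : Prop :=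
  ∀ (W : WeierstrassCurve ℚ) [W.IsElliptic], 4 ∣ W.conductorNorm ℤ →
    ∀ (κ : ZpExtension ℚ 2), κ.IsCyclotomic → ∀ k : ℕ, 1 ≤ k → conductorExponentAtTwo W ≤ 2 * k + 2 →
      ∀ δ : ↥(κ.layer k), IsTowerStepGenerator κ k δ →
        haveI : FiniteDimensional ℚ ↥(κ.layer k) := κ.finiteDimensional_layer_holds k
        haveI : NumberField ↥(κ.layer k) := NumberField.of_module_finite ℚ ↥(κ.layer k)
        ∀ v : HeightOneSpectrum (𝓞 ↥(κ.layer k)), (2 : 𝓞 ↥(κ.layer k)) ∈ v.asIdeal →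
          Even ((padicValNat 2 ((deepTwist W κ k δ).tamagawaNumberAt v) : ℤ)
            + indicatorInt (discHilbertSymbolTwo W = -1)
            + indicatorInt ((deepTwist W κ k δ).kodairaSymbolAt v = .II ∨ (deepTwist W κ k δ).kodairaSymbolAt v = .IIstar))

/-- **(T) Deep-twist Euler parity law = (T_n) of REF2 v28, model-free.**  With `D′ := ord_v Δ_min(W ⊗ η_{k+1}/ℚ_k)` and
`m := v₂(Δ_W)` (any rational model: only `2^k·m mod 24` enters, `k ≥ 1`): `12 ∣ 6 + 2^k·m − D′` (this is `12·(v(u′) − 2^k)` for the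
model `[0, δb₂, 0, 8δ²b₄, 16δ³b₆]` with `v(δ) = 1`) and
`(6 + 2^k·m − D′)/12 + v₂(c′) ≡ [f₂ = 2k + 4] + [(Δ_W, 2)₂ = −1] (mod 2)`.
Scope `k ≥ 1`, `f₂ ≤ 2k + 4`; census 13 382/13 382 (`n = 2, 3, 4`: 12 430 deep + 952 edge cells).  By KT82 Thm 7.6 + DD11 Thm 5
this is EQUIVALENT cell by cell to `LocalTowerSignLawAtTwo` (REF2 v28 §1.3, identity (KTD_n) certified 17 968/17 968); it is the
route-free local target a prover of IMC-LTS has to establish.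
REF1 §113: SURVIVES, `⟺ LocalTowerSignLawAtTwo` cell by cell (REF2 v28 (KTD_n) 17 968/17 968), tagged `@[conjecture]` like IMC-LTS (r4, typer edit);
e1: (T) ∧ (TS) ⟹ (SU) is kernel glue (r5, for the prover's file). -/
@[conjecture] def DeepTwistEulerParityLawAtTwo : Prop :=
  ∀ (W : WeierstrassCurve ℚ) [W.IsElliptic], 4 ∣ W.conductorNorm ℤ →
    ∀ (κ : ZpExtension ℚ 2), κ.IsCyclotomic → ∀ k : ℕ, 1 ≤ k → conductorExponentAtTwo W ≤ 2 * k + 4 →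
      ∀ δ : ↥(κ.layer k), IsTowerStepGenerator κ k δ →
        haveI : FiniteDimensional ℚ ↥(κ.layer k) := κ.finiteDimensional_layer_holds k
        haveI : NumberField ↥(κ.layer k) := NumberField.of_module_finite ℚ ↥(κ.layer k)
        ∀ v : HeightOneSpectrum (𝓞 ↥(κ.layer k)), (2 : 𝓞 ↥(κ.layer k)) ∈ v.asIdeal →
          (12 : ℤ) ∣ 6 + 2 ^ k * padicValRat 2 W.Δ - ((deepTwist W κ k δ).ordMinimalDiscriminant v : ℤ) ∧
          Even ((6 + 2 ^ k * padicValRat 2 W.Δ - ((deepTwist W κ k δ).ordMinimalDiscriminant v : ℤ)) / 12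
            + (padicValNat 2 ((deepTwist W κ k δ).tamagawaNumberAt v) : ℤ)
            + indicatorInt (conductorExponentAtTwo W = 2 * k + 4)
            + indicatorInt (discHilbertSymbolTwo W = -1))

/-- **(TY) Deep-twist Néron type law** (potentially good, `f₂ ≥ 3`).  For `W/ℚ` elliptic with `v₂(j_W) ≥ 0`, `4 ∣ N_W`,
`3 ≤ f₂ ≤ 2k + 2`, `k ≥ 1`, the cyclotomic `κ` and a step generator `δ`, at `v ∣ 2` of `ℚ_k` the deep twist `T = W ⊗ η_{k+1}` has:
(a) if `W` has NO `ℚ₂`-rational `2`-torsion abscissa: `c_v(T) = 1`, and type `I₀*` if `Δ_W ∈ ℚ₂^{×2}`, else `II` when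
`2^k(8 + v₂Δ_W) ≡ 8 (mod 12)` and `II*` when `≡ 4 (mod 12)` (the residue `0` does not occur with `Δ_W ∉ ℚ₂^{×2}`);
(b) if `W` HAS a `ℚ₂`-rational `2`-torsion abscissa: `c_v(T) = 3 + (Δ_W, 2)₂ ∈ {2, 4}` (REF2 v32 r-32b: proved in words on the
half `Δ_W ∈ {1,2,5,10}·ℚ₂^{×2}` by the cusp injection `T(K)[2] ↪ Φ` — -desc §23-add3 rider 4 T2Φ = -imc §10.78 (U); open half =
`LocalTowerSignLawAtTwoCondThreeMPosRam`-type statements, REF2 v32 §1.4 NOT IN PRINT) and type `I*_m` with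
`m = 2^k · max(0, 8 − v₂(j_W))` (`j_W = 0` read as `m = 0`).
Census (REF2 v28 table × -desc `an23/a8.py`): 7 211/7 211 deep cells at `n = 2, 3, 4` (two engines) + 2 719/2 719 curves at `n = 5`
(PARI, j309696); classes (a□) 494, (a¬□) 996, (b, m = 0) 110, (b, m > 0) 1 119 curves; `m_{n+1} = 2 m_n` throughout.  The apparent gap
`8 ≤ v₂(j) ≤ 10` in (b) is EMPTY by an elementary lemma (`y² = x³ + ax² + bx`: `v₂ j ∈ (−∞,7] ∪ {8 + 3t, t ≥ 1} ∪ {∞}`), so the `max`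
is cosmetic.  Why it might fail: a Kraus class of potentially good `W/ℚ₂` not represented below conductor 35 000.
REF1 §113: SURVIVES conjecture-grade, tagged `@[conjecture]` (r4, typer edit); r3: in case (a) «no `ℚ₂`-rational `2`-torsion abscissa ⟹
`Δ_W ∈ ℚ₂^{×2} ∪ −3·ℚ₂^{×2}` (tame cubic `ℚ₂(∛2)`), so in the non-square case `(Δ_W,2)₂ = −1` and `v₂Δ_W` is even» — the lemma that makes (TY)(a)
and (TS) consistent (e2); r1: the hypotheses `0 ≤ v₂ j`, `3 ≤ f₂` are possibly unnecessary (optional stronger row TY♯, 18 877 extra cells, 0 exceptions;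
-desc's call; this is the weaker row). -/
@[conjecture] def DeepTwistNeronTypeLawAtTwo : Prop :=
  ∀ (W : WeierstrassCurve ℚ) [W.IsElliptic], 4 ∣ W.conductorNorm ℤ → 0 ≤ padicValRat 2 W.j →
    ∀ (κ : ZpExtension ℚ 2), κ.IsCyclotomic → ∀ k : ℕ, 1 ≤ k → 3 ≤ conductorExponentAtTwo W →
      conductorExponentAtTwo W ≤ 2 * k + 2 → ∀ δ : ↥(κ.layer k), IsTowerStepGenerator κ k δ →
        haveI : FiniteDimensional ℚ ↥(κ.layer k) := κ.finiteDimensional_layer_holds k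
        haveI : NumberField ↥(κ.layer k) := NumberField.of_module_finite ℚ ↥(κ.layer k)
        ∀ v : HeightOneSpectrum (𝓞 ↥(κ.layer k)), (2 : 𝓞 ↥(κ.layer k)) ∈ v.asIdeal →
          (twoAdicTwoTorsionRootCount W = 0 →
            (deepTwist W κ k δ).tamagawaNumberAt v = 1 ∧
            (IsSquare (W.Δ : ℚ_[2]) → (deepTwist W κ k δ).kodairaSymbolAt v = .Istar 0) ∧
            (¬ IsSquare (W.Δ : ℚ_[2]) →
              ((2 ^ k * (8 + padicValRat 2 W.Δ)) % 12 = 8 → (deepTwist W κ k δ).kodairaSymbolAt v = .II) ∧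
              ((2 ^ k * (8 + padicValRat 2 W.Δ)) % 12 = 4 → (deepTwist W κ k δ).kodairaSymbolAt v = .IIstar))) ∧
          (twoAdicTwoTorsionRootCount W ≠ 0 →
            ((deepTwist W κ k δ).tamagawaNumberAt v : ℤ) = 3 + discHilbertSymbolTwo W ∧
            (deepTwist W κ k δ).kodairaSymbolAt v =
              .Istar (2 ^ k * (if W.j = 0 then 0 else (8 - padicValRat 2 W.j).toNat)))

end Summit.BirchSwinnertonDyer.Rank1Residual.F1Sign2
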